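import Summits.ResolutionOfSingularities.ResolutionOfSingularities.Theorems.PurelyInseparableDim4PiPlateauLetters
import Literature.AlgebraicGeometry.Resolution.CentreBlowupMohStability
import HarnessLib

/-!
# Letter consistency under EVERY coordinate-centre fibre edge: the engines' `d` is the literal `d` in all modes

[OURS · counted 0 · bookkeeping]  Nothing here is a statement about resolution of singularities in dimension ≥ 4 /
characteristic `p`, which is NOT proved.  Sequel of `…PiPlateauLetters` (p665275: MODE 0).  There the closing
caveat said that for coordinate centres `C_S`, `S ≠ univ`, the literal letters (`HauserPerlega.exceptionalExp`,
`residualOrder`) and the bookkept ones (`CState.r`, `CState.shade`) «can differ»; this module shows they do NOT, on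
the edges the engines actually take — FIBRE edges (`b_j = 0`, `b_i = 0` off `S`; crit-1 K-A-10: the census makes no
off-fibre reply) of Hironaka-permissible centres (`q ≤ ord_S F`, condition (1) only — MODE 1h / m1 / 2 alike) from
clean consistent states, `q = p^e`, every field of characteristic `p`, any index type:

* §1 `mem_support_step_centre_iff` — the support of the `C_S`-child is carried onto the support of the POINT child by
  the tree's comparison `ψ(e) = e + (Σ_{i∉S} e_i)·e_j` (`CentreBlowupMohStability`: `lift_step_F`, `coeff_lift`);
  hence `ordAlong_single_step_centre_of_ne` (`ord_{(x_i)}`, `i ≠ j`, agrees for the two children) and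
  **`ordAlong_single_step_centre_self`**: `ord_{(x_j)}` of the `C_S`-child is `ord_S F − q` — lower bound from the
  chart law, upper bound from «every class survives cleaning» (`exists_cls_add_mem_support_step`, p665275) pulled
  back through `ψ`.
* §2 **`step_r_eq_exceptionalExp_centre`** — from a CONSISTENT clean state (`s.r = exceptionalExp s.exc s.F`) the
  child of a fibre edge of any Hironaka-permissible coordinate centre is again consistent; **`shade_step_eq_residualOrder_centre`**:
  its bookkept shade IS the literal residual order.
* §3 Along witnessed fibre chains of the class `(4,1)` (`…Target` vocabulary: `IsPermissibleCentre`) from a clean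
  consistent root: `fibreChain_consistent`, **`shade_eq_residualOrder_of_fibreChain`**.

So every census letter `d` of the cell (MODE 0, 1h, m1, 2; roots `(F, 0, ∅)`) is the literal residual order of
[HauserPerlega2019] §2.  Off-fibre replies (`b_i ≠ 0`, `i ∉ S`: FC-1 «boundary amnesia») are NOT treated.
Typed and proved by res-dim4-typ-1 (g2).  Supports stmt-ResolutionOfSingularities-16155 (helper).
bears_on: LADDER-RESOLUTION:D157-DOOR2 (res-dim4-pi · Π line · letter consistency, all modes).
-/

set_option linter.dupNamespace false -- mandated namespace of this single-conjunct summit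

namespace Summit.ResolutionOfSingularities.ResolutionOfSingularities.Theorems.PIDim4

namespace Plateau

open MvPolynomial Finset
open Literature.AlgebraicGeometry.Resolution
open Literature.AlgebraicGeometry.Resolution.Hauser2010
open Literature.AlgebraicGeometry.Resolution.CentreBlowup
open Literature.Barriers.ResolutionOfSingularities
open Literature.Barriers.ResolutionOfSingularities.HauserPerlega

section General

variable {σ : Type*} [Fintype σ] [DecidableEq σ] {K : Type*} [Field K] [DecidableEq K]

/-! ## §1 Supports of the `C_S`-child and of the point child -/

/-- **Support transfer**: `x^e` occurs in the `C_S`-child iff `x^{ψ(e)}` occurs in the POINT child (same chart `j ∈ S`,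
same fibre point `b`), `ψ(e) = e + (|e| − degIn S e)·e_j`. [folklore] -/
theorem mem_support_step_centre_iff (q : ℕ) {S : Finset σ} {j : σ} (hj : j ∈ S) (b : σ → K) (hbj : b j = 0)
    (hbN : ∀ i, i ∉ S → b i = 0) (s : CState σ K) (hq : ∀ d ∈ s.F.support, q ≤ degIn S d) (e : σ →₀ ℕ) :
    e ∈ (CentreBlowup.step q S j b s).F.support ↔
      e + Finsupp.single j (e.degree - degIn S e) ∈ (CentreBlowup.step q Finset.univ j b s).F.support := by
  rw [MvPolynomial.mem_support_iff, MvPolynomial.mem_support_iff, step_univ_F_eq_pointStep q j b s s.r,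
    show (⟨s.F, s.r⟩ : PointBlowup.State σ K) = s.toState from rfl, ← lift_step_F q hj b hbj hbN s hq, coeff_lift hj]

/-- Every monomial of the point child is `ψ` of a monomial of the `C_S`-child. [folklore] -/
theorem exists_of_mem_support_step_univ (q : ℕ) {S : Finset σ} {j : σ} (hj : j ∈ S) (b : σ → K) (hbj : b j = 0)
    (hbN : ∀ i, i ∉ S → b i = 0) (s : CState σ K) (hq : ∀ d ∈ s.F.support, q ≤ degIn S d) {E : σ →₀ ℕ}
    (hE : E ∈ (CentreBlowup.step q Finset.univ j b s).F.support) :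
    ∃ e ∈ (CentreBlowup.step q S j b s).F.support, e + Finsupp.single j (e.degree - degIn S e) = E := by
  rw [step_univ_F_eq_pointStep q j b s s.r, show (⟨s.F, s.r⟩ : PointBlowup.State σ K) = s.toState from rfl,
    ← lift_step_F q hj b hbj hbN s hq] at hE
  exact exists_of_mem_support_lift S j _ hE

/-- **`ord_{(x_i)}`, `i ≠ j`, is the same for the `C_S`-child and the point child** (`ψ` only moves the `j`-th
exponent). [folklore] -/
theorem ordAlong_single_step_centre_of_ne (q : ℕ) {S : Finset σ} {j : σ} (hj : j ∈ S) (b : σ → K)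
    (hbj : b j = 0) (hbN : ∀ i, i ∉ S → b i = 0) (s : CState σ K) (hq : ∀ d ∈ s.F.support, q ≤ degIn S d)
    {i : σ} (hij : i ≠ j) :
    HauserPerlega.ordAlong i (CentreBlowup.step q S j b s).F =
      HauserPerlega.ordAlong i (CentreBlowup.step q Finset.univ j b s).F := by
  apply le_antisymm
  · refine Finset.le_inf fun E hE => ?_
    obtain ⟨e, he, rfl⟩ := exists_of_mem_support_step_univ q hj b hbj hbN s hq hE
    have h := ordAlong_le_apply_of_mem_support he i
    rwa [lift_apply, if_neg hij]
  · refine Finset.le_inf fun e he => ?_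
    have hE := (mem_support_step_centre_iff q hj b hbj hbN s hq e).mp he
    have h := ordAlong_le_apply_of_mem_support hE i
    rwa [lift_apply, if_neg hij] at h

/-- Lower bound at the chart variable: every monomial of the `C_S`-child has `x_j`-exponent `≥ ord_S F − q`
(chart law; the translation does not touch `x_j`; cleaning only deletes). [folklore] -/
theorem le_apply_self_of_mem_support_step_centre (q : ℕ) (S : Finset σ) (j : σ) (b : σ → K) (hbj : b j = 0)
    (s : CState σ K) {e : σ →₀ ℕ} (he : e ∈ (CentreBlowup.step q S j b s).F.support) {n : ℕ}
    (hn : ∀ d ∈ s.F.support, n ≤ degIn S d) : n - q ≤ e j := by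
  have hpt : coeff e (pointTransform q S j b s) ≠ 0 := by
    intro h
    rw [MvPolynomial.mem_support_iff,
      show (CentreBlowup.step q S j b s).F = deletePthPowers q (pointTransform q S j b s) from rfl,
      coeff_deletePthPowers] at he
    split_ifs at he with hP
    · exact he rfl
    · exact he h
  unfold pointTransform at hpt
  rw [PointBlowup.translate_eq_sum_support, coeff_sum] at hpt
  obtain ⟨E, hE, hne⟩ := Finset.exists_ne_zero_of_sum_ne_zero hpt
  have hej : e j = E j := PointBlowup.apply_eq_of_coeff_translate_monomial_ne_zero _ hbj hne
  obtain ⟨d, hd, -, rfl⟩ := PointBlowup.exists_of_mem_support_sum_monomial _ _ _ hE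
  rw [hej, chartExponent_apply_self]
  exact Nat.sub_le_sub_right (hn d hd) q

/-- **`ord_{(x_j)}` of the `C_S`-child is `ord_S F − q`** (clean parent, `q = p^e ≤ ord_S F`, fibre point): the
bookkept new multiplicity.  The upper bound pulls a surviving class monomial of the point child
(`exists_cls_add_mem_support_step`) back through `ψ`. [folklore] -/
theorem ordAlong_single_step_centre_self (p : ℕ) [Fact p.Prime] [CharP K p] (e : ℕ) {S : Finset σ} {j : σ}
    (hj : j ∈ S) (b : σ → K) (hbj : b j = 0) (hbN : ∀ i, i ∉ S → b i = 0) (s : CState σ K)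
    (hclean : IsClean (p ^ e) s.F) (hF0 : s.F ≠ 0) (hq : ∀ d ∈ s.F.support, p ^ e ≤ degIn S d) :
    HauserPerlega.ordAlong j (CentreBlowup.step (p ^ e) S j b s).F =
      (((CentreBlowup.ordAlong S s.F).toNat - p ^ e : ℕ) : ℕ∞) := by
  set q := p ^ e with hqdef
  -- a monomial of `F` realising `ord_S F`
  have hne : s.F.support.Nonempty := MvPolynomial.support_nonempty.mpr hF0
  obtain ⟨b₀, hb₀, hb₀min⟩ := Finset.exists_mem_eq_inf s.F.support hne (fun d => ((degIn S d : ℕ) : ℕ∞))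
  have hordS : CentreBlowup.ordAlong S s.F = ((degIn S b₀ : ℕ) : ℕ∞) := hb₀min
  have hordSnat : (CentreBlowup.ordAlong S s.F).toNat = degIn S b₀ := by rw [hordS, ENat.toNat_coe]
  have hmin : ∀ d ∈ s.F.support, degIn S b₀ ≤ degIn S d := fun d hd => by
    have := Finset.inf_le (f := fun d => ((degIn S d : ℕ) : ℕ∞)) hd
    rw [hb₀min] at this
    exact_mod_cast this
  rw [hordSnat]
  apply le_antisymm
  · -- upper bound: the class of `b₀` survives in the point child; pull back through `ψ`
    have hqdeg : ∀ d ∈ s.F.support, q ≤ d.degree := fun d hd => (hq d hd).trans (degIn_le_degree S d)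
    obtain ⟨k, hk, hD⟩ := exists_cls_add_mem_support_step p e hbj s hclean hqdeg hb₀
    obtain ⟨e', he', hlift⟩ := exists_of_mem_support_step_univ q hj b hbj hbN s hq hD
    have hku := uPart_eq_zero_of_mem_support_classPoly q j b s.F hk
    -- read off `e' j` from `ψ(e') = cls b₀ + k`
    have hj' : e' j + (e'.degree - degIn S e') = b₀.degree - q := by
      have h := DFunLike.congr_fun hlift j
      rw [lift_apply, if_pos rfl, Finsupp.coe_add, Pi.add_apply, apply_eq_zero_of_uPart_eq_zero b hku hbj,
        add_zero, cls_apply, if_pos rfl] at h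
      exact h
    have hoff : ∀ i, i ∉ S → e' i = b₀ i := by
      intro i hi
      have hij : i ≠ j := fun h => hi (h ▸ hj)
      have h := DFunLike.congr_fun hlift i
      rw [lift_apply, if_neg hij, Finsupp.coe_add, Pi.add_apply, apply_eq_zero_of_uPart_eq_zero b hku (hbN i hi),
        add_zero, cls_apply, if_neg hij, if_pos (hbN i hi)] at h
      exact h
    have hsum : e'.degree - degIn S e' = b₀.degree - degIn S b₀ := by
      have h1 := degIn_add_sum_compl S e'
      have h2 := degIn_add_sum_compl S b₀
      have h3 : ∑ i ∈ Sᶜ, e' i = ∑ i ∈ Sᶜ, b₀ i :=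
        Finset.sum_congr rfl fun i hi => hoff i (Finset.mem_compl.mp hi)
      omega
    have hb₀q : q ≤ degIn S b₀ := hq b₀ hb₀
    have hb₀d := degIn_le_degree S b₀
    have hval : e' j = degIn S b₀ - q := by omega
    have h := ordAlong_le_apply_of_mem_support he' j
    rw [hval] at h
    exact h
  · -- lower bound: the chart law
    exact natCast_le_ordAlong_of_forall_mem_support j _ fun e he =>
      le_apply_self_of_mem_support_step_centre q S j b hbj s he hmin

/-! ## §2 Consistency persists under every fibre edge -/

/-- The new exceptional sets agree (`{j} ∪ {i ∈ Δ : b_i = 0}` for both children). [folklore] -/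
theorem step_exc_centre_eq_univ (q : ℕ) (S : Finset σ) (j : σ) (b : σ → K) (s : CState σ K) :
    (CentreBlowup.step q S j b s).exc = (CentreBlowup.step q Finset.univ j b s).exc := rfl

/-- **CONSISTENCY PERSISTS UNDER EVERY FIBRE EDGE OF EVERY HIRONAKA-PERMISSIBLE COORDINATE CENTRE**: from a clean
consistent state (`s.r = exceptionalExp s.exc s.F`, `q = p^e ≤ ord_S F`), at a fibre point (`b_j = 0`, `b = 0` off
`S`) of the chart `j ∈ S`, the bookkept multiplicities of the child ARE its literal exceptional exponent. [folklore] -/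
theorem step_r_eq_exceptionalExp_centre (p : ℕ) [Fact p.Prime] [CharP K p] (e : ℕ) {S : Finset σ} {j : σ}
    (hj : j ∈ S) (b : σ → K) (hbj : b j = 0) (hbN : ∀ i, i ∉ S → b i = 0) (s : CState σ K)
    (hclean : IsClean (p ^ e) s.F) (hF0 : s.F ≠ 0) (hq : ∀ d ∈ s.F.support, p ^ e ≤ degIn S d)
    (hcons : s.r = exceptionalExp s.exc s.F) :
    (CentreBlowup.step (p ^ e) S j b s).r =
      exceptionalExp (CentreBlowup.step (p ^ e) S j b s).exc (CentreBlowup.step (p ^ e) S j b s).F := by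
  set q := p ^ e with hqdef
  -- the point child from the same state is consistent (MODE-0 file)
  have hqo : ((p ^ e : ℕ) : ℕ∞) ≤ ordZero s.F := by
    rw [← CentreBlowup.ordAlong_univ]
    exact le_ordAlong_of_forall fun d hd => (hq d hd).trans (by rw [degIn_univ]; exact degIn_le_degree S d)
  have huniv := step_r_eq_exceptionalExp p e s j b hbj hclean hF0 hqo hcons
  ext i
  by_cases hij : i = j
  · subst hij
    -- both sides are `ord_S F − q`
    rw [exceptionalExp_apply_eq_toNat_of_mem _ (show i ∈ (CentreBlowup.step q S i b s).exc from
      Finset.mem_insert_self _ _), ordAlong_single_step_centre_self p e hj b hbj hbN s hclean hF0 hq, ENat.toNat_coe]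
    show ((s.r.filter fun k => b k = 0).update i ((CentreBlowup.ordAlong S s.F).toNat - q)) i = _
    rw [Finsupp.update_apply, if_pos rfl]
  · -- off the chart variable: transfer through the point child
    rw [step_r_apply_of_ne q S hij b s, show (PointBlowup.step q j b s.toState).r i =
      (CentreBlowup.step q Finset.univ j b s).r i from (step_r_apply_of_ne q Finset.univ hij b s).symm, huniv]
    by_cases hmem : i ∈ (CentreBlowup.step q S j b s).exc
    · rw [exceptionalExp_apply_eq_toNat_of_mem _ hmem, step_exc_centre_eq_univ,
        exceptionalExp_apply_eq_toNat_of_mem _ (by rwa [step_exc_centre_eq_univ] at hmem),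
        ordAlong_single_step_centre_of_ne q hj b hbj hbN s hq hij]
    · rw [exceptionalExp_apply_eq_zero_of_not_mem _ hmem, step_exc_centre_eq_univ,
        exceptionalExp_apply_eq_zero_of_not_mem _ (by rwa [step_exc_centre_eq_univ] at hmem)]

/-- **The bookkept shade of the child of any Hironaka-permissible fibre edge is its literal residual order**
(clean consistent parent). [folklore] -/
theorem shade_step_eq_residualOrder_centre (p : ℕ) [Fact p.Prime] [CharP K p] (e : ℕ) {S : Finset σ} {j : σ}
    (hj : j ∈ S) (b : σ → K) (hbj : b j = 0) (hbN : ∀ i, i ∉ S → b i = 0) (s : CState σ K)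
    (hclean : IsClean (p ^ e) s.F) (hF0 : s.F ≠ 0) (hq : ∀ d ∈ s.F.support, p ^ e ≤ degIn S d)
    (hcons : s.r = exceptionalExp s.exc s.F) :
    (CentreBlowup.step (p ^ e) S j b s).shade =
      residualOrder (CentreBlowup.step (p ^ e) S j b s).exc (CentreBlowup.step (p ^ e) S j b s).F :=
  shade_eq_residualOrder _ (step_r_eq_exceptionalExp_centre p e hj b hbj hbN s hclean hF0 hq hcons)

end General

/-! ## §3 Witnessed fibre chains of the class `(4,1)` -/

section Chains

variable {K : Type} [Field K] [DecidableEq K]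

/-- **Along every witnessed FIBRE chain of Hironaka-permissible coordinate centres** (any mode of the cell: centres
`S n` with `q = p^e ≤ ord_{S n}`, charts `j n ∈ S n`, fibre points `b n`, non-zero children) **from a clean consistent
root, every state is consistent.** [folklore] -/
theorem fibreChain_consistent (p : ℕ) [Fact p.Prime] [CharP K p] (e : ℕ) {c : ℕ → State K}
    {S : ℕ → Finset (Fin 4)} {j : ℕ → Fin 4} {b : ℕ → Fin 4 → K} (hj : ∀ n, j n ∈ S n)
    (hbj : ∀ n, b n (j n) = 0) (hbN : ∀ n i, i ∉ S n → b n i = 0)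
    (hperm : ∀ n, IsPermissibleCentre (p ^ e) (S n) (c n).F)
    (hne : ∀ n, (CentreBlowup.step (p ^ e) (S n) (j n) (b n) (c n)).F ≠ 0)
    (hstep : ∀ n, c (n + 1) = CentreBlowup.step (p ^ e) (S n) (j n) (b n) (c n))
    (h0 : IsClean (p ^ e) (c 0).F) (hF0 : (c 0).F ≠ 0) (hcons : (c 0).r = exceptionalExp (c 0).exc (c 0).F)
    (n : ℕ) : (c n).r = exceptionalExp (c n).exc (c n).F := by
  induction n with
  | zero => exact hcons
  | succ n ih =>
    have hclean : IsClean (p ^ e) (c n).F := by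
      cases n with
      | zero => exact h0
      | succ n => rw [hstep n]; exact isClean_deletePthPowers _ _
    have hFn : (c n).F ≠ 0 := by
      cases n with
      | zero => exact hF0
      | succ n => rw [hstep n]; exact hne n
    have hq : ∀ d ∈ (c n).F.support, p ^ e ≤ degIn (S n) d := fun d hd => by
      have h := (le_ordAlong_iff.mp (hperm n).2) d hd
      exact_mod_cast h
    rw [hstep n]
    exact step_r_eq_exceptionalExp_centre p e (hj n) (b n) (hbj n) (hbN n) (c n) hclean hFn hq ih

/-- **THE ENGINES' `d` IS THE LITERAL `d` ON EVERY WITNESSED FIBRE CHAIN** (MODE 1h / m1 / 2 / 0 alike) from a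
clean consistent root: `(c n).shade = residualOrder (c n).exc (c n).F`. [folklore] -/
theorem shade_eq_residualOrder_of_fibreChain (p : ℕ) [Fact p.Prime] [CharP K p] (e : ℕ) {c : ℕ → State K}
    {S : ℕ → Finset (Fin 4)} {j : ℕ → Fin 4} {b : ℕ → Fin 4 → K} (hj : ∀ n, j n ∈ S n)
    (hbj : ∀ n, b n (j n) = 0) (hbN : ∀ n i, i ∉ S n → b n i = 0)
    (hperm : ∀ n, IsPermissibleCentre (p ^ e) (S n) (c n).F)
    (hne : ∀ n, (CentreBlowup.step (p ^ e) (S n) (j n) (b n) (c n)).F ≠ 0)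
    (hstep : ∀ n, c (n + 1) = CentreBlowup.step (p ^ e) (S n) (j n) (b n) (c n))
    (h0 : IsClean (p ^ e) (c 0).F) (hF0 : (c 0).F ≠ 0) (hcons : (c 0).r = exceptionalExp (c 0).exc (c 0).F)
    (n : ℕ) : (c n).shade = residualOrder (c n).exc (c n).F :=
  shade_eq_residualOrder _ (fibreChain_consistent p e hj hbj hbN hperm hne hstep h0 hF0 hcons n)

end Chains

end Plateau

end Summit.ResolutionOfSingularities.ResolutionOfSingularities.Theorems.PIDim4
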